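import Literature.Geometry.Lorentzian.MassCapacity
import Literature.Geometry.Lorentzian.RiemannianVolumeIsometry
import Literature.Geometry.Lorentzian.EndChartIntegral
import Literature.Geometry.Lorentzian.IsometryProofs
import HarnessLib

/-!
# Isometry invariance of the slope, the Dirichlet energy and the capacity of a horizon

Companion of `MassCapacity.lean` (Bray's capacity `ℰ(Σ, g) = horizonCapacity h e U` of the
horizon `Σ = ∂U`, Def. 17, and its test functions `IsCapacityTestFn e U`) and of
`RiemannianVolumeIsometry.lean` (isometric diffeomorphisms preserve the Riemannian measure).
Bray, J. Differential Geom. 59 (2001), §6, proof of Thm. 9, transfers energies and capacities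
computed on the outside region `(M³_Σ, g)` to the smoothed double through (94): *"Then it follows
that `(M̃³_{Σ,δ}, ḡ_δ)` is smooth with `R(ḡ_δ) ≥ 0`, has two asymptotically flat ends, […] and has
two regions which are isometric to `(M³_Σ, g)`."* This file proves the invariance statements
that sentence relies on, for a `C^∞` diffeomorphism `Φ : X' ≃ X` of `3`-manifolds which is an
isometry of Riemannian initial data, `h(dΦ v, dΦ w) = h'(v, w)` (hypothesis `hiso`; e.g. the
pulled-back data `Φ^* D` of `InitialDataPullback.lean`), and which matches the structures at
infinity of two ends `e'` of `X'` and `e` of `X` (same inner radius `hR : e'.R = e.R` and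
`Φ ∘ Φ_{e'} = Φ_e` on `{R < ‖z‖} ⊆ ℝ³`, hypothesis `hchart`; no transport of `AFEnd`s along
diffeomorphisms is defined here):

* `endValue_comp_eq`, `tendstoAtEnd_comp_iff` — functions read at infinity and limits at
  infinity correspond (`endValue e' (φ ∘ Φ) = endValue e φ`);
* `preimage_far_eq`, `image_far_eq` — `Φ⁻¹(e.far R') = e'.far R'`;
  `isExteriorRegion_comp_iff` — for `U' = Φ⁻¹(U)`, `U'` is the exterior region of `e'` iff `U`
  is that of `e`;
* `isCapacityTestFn_comp_iff`, `isCapacityTestFn_comp_symm_iff` — `φ ↦ φ ∘ Φ` is a bijection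
  between the test functions of `(e, U)` and of `(e', U')`;
* `InitialDataSet.metric_eq_comap_of_inner_eq` — under `hiso`, `D'.metric` is the pullback
  metric `Φ^* D.metric` of `Isometry.lean`; `gradNorm_comp_eq` — **the slope is invariant**,
  `|∇(u ∘ Φ)|_{h'}(x) = |∇u|_h(Φ x)` (naturality of the inverse metric on covectors,
  `innerDual_mvfderiv_comp` of `EndChartIntegral.lean`; O'Neill 1983, Ch. 3, Prop. 3.59 ff.);
* `dirichletEnergy_comp_eq`, `setLIntegral_gradNorm_sq_comp_eq` — **the Dirichlet energy is
  invariant**, `∫_{X'} |∇(u ∘ Φ)|² dV_{h'} = ∫_X |∇u|² dV_h` (and over `Φ⁻¹ A` vs `A`), by the change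
  of variables `Diffeomorph.lintegral_comp_riemannianMeasure`;
* `horizonCapacity_comp_eq` — **the capacity is invariant**: `ℰ(∂U', h') = ℰ(∂U, h)`.

Everything is proved; no definitions and no named facts are introduced.

## References

* H. L. Bray, *Proof of the Riemannian Penrose inequality using the positive mass theorem*,
  J. Differential Geom. 59 (2001) 177–267 (arXiv:math/9911173), §6 Defs. 16–17 and the proof of
  Thm. 9, (94). [BrayRPI2001]
* B. O'Neill, *Semi-Riemannian Geometry with Applications to Relativity*, Academic Press 1983,
  Ch. 3, Def. 3.4 (isometries), Prop. 3.59 ff. (naturality under isometries). [ONeill1983]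
* J. M. Lee, *Introduction to Riemannian Manifolds*, 2nd ed., Springer 2018, Prop. 2.51
  (isometry invariance of lengths and of the Riemannian volume). [Lee2018]
-/

noncomputable section

open Bundle Set Manifold TopologicalSpace Filter MeasureTheory Function
open scoped ContDiff Topology Manifold Real

namespace Literature.Geometry.Lorentzian

open PseudoRiemannianMetric

variable {X : Type} [TopologicalSpace X] [ChartedSpace E3 X] [IsManifold (𝓡 3) ∞ X]
  {X' : Type} [TopologicalSpace X'] [ChartedSpace E3 X'] [IsManifold (𝓡 3) ∞ X']

/-! ### Ends matched by a diffeomorphism -/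

section Ends

variable {Φ : Diffeomorph (𝓡 3) (𝓡 3) X' X ∞} {e : AFEnd X} {e' : AFEnd X'}

omit [IsManifold (𝓡 3) ∞ X] [IsManifold (𝓡 3) ∞ X'] in
/-- If `Φ` maps the structure at infinity of `e'` to that of `e` (same inner radius, and
`Φ ∘ Φ_{e'} = Φ_e` on the exterior region of `ℝ³`, `Φ_e = e.dataChart`), then functions read in
the chart agree: `endValue e' (φ ∘ Φ) = endValue e φ`. [folklore] -/
theorem endValue_comp_eq (hR : e'.R = e.R)
    (hchart : ∀ (z : E3) (hz' : e'.R < ‖z‖) (hz : e.R < ‖z‖),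
      Φ (e'.dataChart ⟨z, hz'⟩) = e.dataChart ⟨z, hz⟩)
    (φ : X → ℝ) : endValue e' (φ ∘ Φ) = endValue e φ := by
  funext z
  by_cases hz : e.R < ‖z‖
  · have hz' : e'.R < ‖z‖ := hR ▸ hz
    rw [endValue_of_lt e' _ hz', endValue_of_lt e _ hz, Function.comp_apply, hchart z hz' hz]
  · have hz' : ¬ e'.R < ‖z‖ := hR ▸ hz
    rw [endValue_of_not_lt e' _ hz', endValue_of_not_lt e _ hz]

omit [IsManifold (𝓡 3) ∞ X] [IsManifold (𝓡 3) ∞ X'] in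
/-- With matched ends, `φ ∘ Φ → c` at infinity in `e'` iff `φ → c` at infinity in `e`.
[folklore] -/
theorem tendstoAtEnd_comp_iff (hR : e'.R = e.R)
    (hchart : ∀ (z : E3) (hz' : e'.R < ‖z‖) (hz : e.R < ‖z‖),
      Φ (e'.dataChart ⟨z, hz'⟩) = e.dataChart ⟨z, hz⟩)
    (φ : X → ℝ) (c : ℝ) : TendstoAtEnd e' (φ ∘ Φ) c ↔ TendstoAtEnd e φ c := by
  simp only [TendstoAtEnd, endValue_comp_eq hR hchart]

omit [IsManifold (𝓡 3) ∞ X] [IsManifold (𝓡 3) ∞ X'] in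
/-- With matched ends, `Φ` pulls the far regions of `e` back to those of `e'`:
`Φ⁻¹(e.far R') = e'.far R'`. [folklore] -/
theorem preimage_far_eq (hR : e'.R = e.R)
    (hchart : ∀ (z : E3) (hz' : e'.R < ‖z‖) (hz : e.R < ‖z‖),
      Φ (e'.dataChart ⟨z, hz'⟩) = e.dataChart ⟨z, hz⟩)
    (R' : ℝ) : Φ ⁻¹' e.far R' = e'.far R' := by
  ext q
  rw [mem_preimage, AFEnd.mem_far_iff, AFEnd.mem_far_iff]
  constructor
  · rintro ⟨z, hzR, hzq⟩
    have hz : e.R < ‖(z : E3)‖ := z.2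
    have hz' : e'.R < ‖(z : E3)‖ := by rw [hR]; exact hz
    refine ⟨⟨z, hz'⟩, hzR, ?_⟩
    have h := (hchart (z : E3) hz' hz).trans hzq
    simpa using congrArg Φ.symm h
  · rintro ⟨z, hzR, rfl⟩
    have hz' : e'.R < ‖(z : E3)‖ := z.2
    have hz : e.R < ‖(z : E3)‖ := by rw [← hR]; exact hz'
    exact ⟨⟨z, hz⟩, hzR, (hchart (z : E3) hz' hz).symm⟩

omit [IsManifold (𝓡 3) ∞ X] [IsManifold (𝓡 3) ∞ X'] in
/-- With matched ends, `Φ` maps the far regions of `e'` onto those of `e`: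
`Φ(e'.far R') = e.far R'`. [folklore] -/
theorem image_far_eq (hR : e'.R = e.R)
    (hchart : ∀ (z : E3) (hz' : e'.R < ‖z‖) (hz : e.R < ‖z‖),
      Φ (e'.dataChart ⟨z, hz'⟩) = e.dataChart ⟨z, hz⟩)
    (R' : ℝ) : Φ '' e'.far R' = e.far R' := by
  rw [← preimage_far_eq hR hchart R',
    Set.image_preimage_eq _ fun y ↦ ⟨Φ.symm y, Φ.apply_symm_apply y⟩]

omit [IsManifold (𝓡 3) ∞ X] [IsManifold (𝓡 3) ∞ X'] in
/-- **Exterior regions correspond under a diffeomorphism matching the ends**: for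
`U' = Φ⁻¹(U)`, `U'` is the exterior region of `e'` iff `U` is the exterior region of `e`
(connectedness, the far regions and compactness modulo the end are transported by the
homeomorphism `Φ`). Huisken–Ilmanen 2001, §0. [folklore] -/
theorem isExteriorRegion_comp_iff (hR : e'.R = e.R)
    (hchart : ∀ (z : E3) (hz' : e'.R < ‖z‖) (hz : e.R < ‖z‖),
      Φ (e'.dataChart ⟨z, hz'⟩) = e.dataChart ⟨z, hz⟩)
    {U : Opens X} {U' : Opens X'} (hU : (U' : Set X') = Φ ⁻¹' (U : Set X)) :
    IsExteriorRegion e' U' ↔ IsExteriorRegion e U := by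
  have hcl : closure (U' : Set X') = Φ ⁻¹' closure (U : Set X) := by
    rw [hU]
    exact (Φ.toHomeomorph.preimage_closure (U : Set X)).symm
  simp only [IsExteriorRegion, hR]
  refine and_congr ?_ (exists_congr fun R' ↦ and_congr Iff.rfl (and_congr ?_ ?_))
  · rw [hU]
    exact Φ.toHomeomorph.isConnected_preimage
  · rw [hU, ← preimage_far_eq hR hchart R']
    constructor
    · intro h x hx
      obtain ⟨x', rfl⟩ := Φ.surjective x
      exact h hx
    · exact fun h ↦ preimage_mono h
  · rw [hcl, ← preimage_far_eq hR hchart R', ← preimage_sdiff]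
    exact Φ.toHomeomorph.isCompact_preimage

end Ends

/-! ### Test functions -/

section TestFn

variable {Φ : Diffeomorph (𝓡 3) (𝓡 3) X' X ∞} {e : AFEnd X} {e' : AFEnd X'}

omit [IsManifold (𝓡 3) ∞ X] [IsManifold (𝓡 3) ∞ X'] in
/-- **Test functions correspond**: with matched ends and `U' = Φ⁻¹(U)`, `φ ∘ Φ` is a capacity
test function for `(e', U')` iff `φ` is one for `(e, U)` (continuity, smoothness on the open
outside region, vanishing off it and the limit `1` at infinity are transported by the
diffeomorphism). Bray 2001, §6, Def. 17 with (94). [folklore] -/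
theorem isCapacityTestFn_comp_iff (hR : e'.R = e.R)
    (hchart : ∀ (z : E3) (hz' : e'.R < ‖z‖) (hz : e.R < ‖z‖),
      Φ (e'.dataChart ⟨z, hz'⟩) = e.dataChart ⟨z, hz⟩)
    {U : Opens X} {U' : Opens X'} (hU : (U' : Set X') = Φ ⁻¹' (U : Set X)) (φ : X → ℝ) :
    IsCapacityTestFn e' U' (φ ∘ Φ) ↔ IsCapacityTestFn e U φ := by
  have h1 : Continuous (φ ∘ Φ) ↔ Continuous φ := Φ.toHomeomorph.comp_continuous_iff'
  have h2 : ContMDiffOn (𝓡 3) 𝓘(ℝ, ℝ) ∞ (φ ∘ Φ) (U' : Set X') ↔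
      ContMDiffOn (𝓡 3) 𝓘(ℝ, ℝ) ∞ φ (U : Set X) := by
    rw [Φ.contMDiffOn_comp_diffeomorph_iff le_rfl, hU, ← preimage_comp]
    have : (Φ : X' → X) ∘ Φ.symm = id := funext fun x ↦ Φ.apply_symm_apply x
    rw [this, preimage_id]
  have h3 : (∀ x, x ∉ (U' : Set X') → (φ ∘ Φ) x = 0) ↔ ∀ x, x ∉ (U : Set X) → φ x = 0 := by
    rw [hU]
    constructor
    · intro h x hx
      obtain ⟨x', rfl⟩ := Φ.surjective x
      exact h x' hx
    · exact fun h x' hx' ↦ h (Φ x') hx'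
  simp only [IsCapacityTestFn, h1, h2, h3, tendstoAtEnd_comp_iff hR hchart]

omit [IsManifold (𝓡 3) ∞ X] [IsManifold (𝓡 3) ∞ X'] in
/-- The same correspondence read from the side of `X'`: `ψ` is a test function for `(e', U')`
iff `ψ ∘ Φ⁻¹` is one for `(e, U)`. [folklore] -/
theorem isCapacityTestFn_comp_symm_iff (hR : e'.R = e.R)
    (hchart : ∀ (z : E3) (hz' : e'.R < ‖z‖) (hz : e.R < ‖z‖),
      Φ (e'.dataChart ⟨z, hz'⟩) = e.dataChart ⟨z, hz⟩)
    {U : Opens X} {U' : Opens X'} (hU : (U' : Set X') = Φ ⁻¹' (U : Set X)) (ψ : X' → ℝ) :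
    IsCapacityTestFn e U (ψ ∘ Φ.symm) ↔ IsCapacityTestFn e' U' ψ := by
  rw [← isCapacityTestFn_comp_iff hR hchart hU (ψ ∘ Φ.symm)]
  have : (ψ ∘ Φ.symm) ∘ (Φ : X' → X) = ψ := funext fun x ↦ by simp
  rw [this]

end TestFn

/-! ### The slope and the Dirichlet energy under an isometry -/

section Energy

variable (D : InitialDataSet (𝓡 3) X) (D' : InitialDataSet (𝓡 3) X')
  (Φ : Diffeomorph (𝓡 3) (𝓡 3) X' X ∞)
  (hiso : ∀ (x : X') (v w : TangentSpace (𝓡 3) x),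
    D.h.inner (Φ x) (mfderiv (𝓡 3) (𝓡 3) Φ x v) (mfderiv (𝓡 3) (𝓡 3) Φ x w) = D'.h.inner x v w)

omit [IsManifold (𝓡 3) ∞ X] [IsManifold (𝓡 3) ∞ X'] in
/-- The differentials of a `C^∞` diffeomorphism are injective. [folklore] -/
theorem Diffeomorph.mfderiv_injective (x : X') : Function.Injective (mfderiv (𝓡 3) (𝓡 3) Φ x) :=
  (Φ.mfderivToContinuousLinearEquiv (by simp) x).injective

include hiso in
/-- Under `h(dΦ v, dΦ w) = h'(v, w)` the metric of `D'` **is** the pullback metric `Φ^* h` of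
`Isometry.lean` (extensionality of `PseudoRiemannianMetric`). [folklore] -/
theorem InitialDataSet.metric_eq_comap_of_inner_eq :
    D'.metric = D.metric.comap contMDiff_pullbackBilin_holds Φ Φ.contMDiff
      (Diffeomorph.mfderiv_injective Φ) rfl := by
  refine PseudoRiemannianMetric.ext (funext fun x ↦ ?_)
  ext v w
  rw [val_comap, pullbackBilin_apply, InitialDataSet.val_metric, InitialDataSet.val_metric]
  exact (hiso x v w).symm

include hiso in
/-- **The slope is invariant under isometries**: `|∇(u ∘ Φ)|_{h'}(x) = |∇u|_h(Φ x)` when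
`h(dΦ v, dΦ w) = h'(v, w)` (naturality of the inverse metric on covectors,
`innerDual_mvfderiv_comp`, and the chain rule; where `u` is not differentiable at `Φ x`,
`u ∘ Φ` is not differentiable at `x` and both slopes are the junk value `0`). O'Neill 1983,
Ch. 3, Prop. 3.59 ff. [folklore] -/
theorem gradNorm_comp_eq (u : X → ℝ) (x : X') :
    gradNorm D'.h (u ∘ Φ) x = gradNorm D.h u (Φ x) := by
  by_cases hu : MDifferentiableAt (𝓡 3) 𝓘(ℝ, ℝ) u (Φ x)
  · have hl : ∀ {Y : Type} [TopologicalSpace Y] [ChartedSpace E3 Y] (f : Y → ℝ) (y : Y),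
        (mfderiv (𝓡 3) 𝓘(ℝ, ℝ) f y).toLinearMap = (mvfderiv (𝓡 3) f y).toLinearMap :=
      fun f y ↦ LinearMap.ext fun _ ↦ rfl
    unfold gradNorm
    congr 1
    rw [hl, hl]
    change D'.metric.innerDual x _ _ = D.metric.innerDual (Φ x) _ _
    rw [InitialDataSet.metric_eq_comap_of_inner_eq D D' Φ hiso]
    exact innerDual_mvfderiv_comp D.metric contMDiff_pullbackBilin_holds Φ.contMDiff
      (Diffeomorph.mfderiv_injective Φ) rfl x hu hu
  · have hu' : ¬ MDifferentiableAt (𝓡 3) 𝓘(ℝ, ℝ) (u ∘ Φ) x := by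
      intro h
      apply hu
      have h' : MDifferentiableAt (𝓡 3) 𝓘(ℝ, ℝ) (u ∘ Φ) (Φ.symm (Φ x)) := by
        rwa [Φ.symm_apply_apply]
      have hc := h'.comp (Φ x) (Φ.symm.mdifferentiable (by simp) (Φ x))
      have hfun : (u ∘ Φ) ∘ Φ.symm = u := funext fun y ↦ by simp
      rwa [hfun] at hc
    simp only [gradNorm, mfderiv_zero_of_not_mdifferentiableAt hu,
      mfderiv_zero_of_not_mdifferentiableAt hu']
    rfl

variable [T2Space X] [LocallyCompactSpace X] [MeasurableSpace X] [BorelSpace X]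
  [T2Space X'] [LocallyCompactSpace X'] [MeasurableSpace X'] [BorelSpace X']

include hiso in
/-- **The Dirichlet energy is invariant under isometries**:
`∫_{X'} |∇(u ∘ Φ)|²_{h'} dV_{h'} = ∫_X |∇u|²_h dV_h` (slope invariance and the change of
variables `Φ_* dV_{h'} = dV_h`, `Diffeomorph.lintegral_comp_riemannianMeasure`). Bray 2001, §6,
Def. 16 with (94). [folklore] -/
theorem dirichletEnergy_comp_eq (u : X → ℝ) :
    dirichletEnergy D'.h (u ∘ Φ) = dirichletEnergy D.h u := by
  simp only [dirichletEnergy, gradNorm_comp_eq D D' Φ hiso]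
  exact Diffeomorph.lintegral_comp_riemannianMeasure Φ (by simp) (fun x v ↦ hiso x v v)
    (fun y ↦ ENNReal.ofReal (gradNorm D.h u y ^ 2))

include hiso in
/-- **The Dirichlet energy over corresponding regions is invariant**:
`∫_{Φ⁻¹ A} |∇(u ∘ Φ)|²_{h'} dV_{h'} = ∫_A |∇u|²_h dV_h`. [folklore] -/
theorem setLIntegral_gradNorm_sq_comp_eq (u : X → ℝ) (A : Set X) :
    ∫⁻ x in Φ ⁻¹' A, ENNReal.ofReal (gradNorm D'.h (u ∘ Φ) x ^ 2) ∂(riemannianMeasure D'.h) =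
      ∫⁻ y in A, ENNReal.ofReal (gradNorm D.h u y ^ 2) ∂(riemannianMeasure D.h) := by
  simp only [gradNorm_comp_eq D D' Φ hiso]
  exact Diffeomorph.setLIntegral_comp_riemannianMeasure Φ (by simp) (fun x v ↦ hiso x v v)
    (fun y ↦ ENNReal.ofReal (gradNorm D.h u y ^ 2)) A

/-! ### The capacity of a horizon under an isometry matching the ends -/

variable {e : AFEnd X} {e' : AFEnd X'}

include hiso in
/-- **The capacity of a horizon is an isometry invariant**: if `Φ : (X', h') ≃ (X, h)` is an
isometry (`h(dΦ v, dΦ w) = h'(v, w)`) matching the structures at infinity of the ends `e'`, `e`,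
and `U' = Φ⁻¹(U)`, then `ℰ(∂U', h') = ℰ(∂U, h)` (`horizonCapacity`): `φ ↦ φ ∘ Φ` is a bijection
of the classes of test functions preserving the Dirichlet energy. This is the use of (94) in
the proof of Bray's Thm. 9: *"`(M̃³_{Σ,δ}, ḡ_δ)` is smooth with `R(ḡ_δ) ≥ 0`, has two
asymptotically flat ends, is spherically symmetric [sic: reflection symmetric], and has two
regions which are isometric to `(M³_Σ, g)`"*, so that energies computed on `M³_Σ` are energies
on the double. [cite: BrayRPI2001, §6 Def. 17 with (94)] -/
theorem horizonCapacity_comp_eq (hR : e'.R = e.R)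
    (hchart : ∀ (z : E3) (hz' : e'.R < ‖z‖) (hz : e.R < ‖z‖),
      Φ (e'.dataChart ⟨z, hz'⟩) = e.dataChart ⟨z, hz⟩)
    {U : Opens X} {U' : Opens X'} (hU : (U' : Set X') = Φ ⁻¹' (U : Set X)) :
    horizonCapacity D'.h e' U' = horizonCapacity D.h e U := by
  refine le_antisymm (le_iInf₂ fun φ hφ ↦ ?_) (le_iInf₂ fun ψ hψ ↦ ?_)
  · -- `φ ∘ Φ` is a test function for `(e', U')` with the same energy
    have hφ' : IsCapacityTestFn e' U' (φ ∘ Φ) := (isCapacityTestFn_comp_iff hR hchart hU φ).2 hφ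
    calc horizonCapacity D'.h e' U'
        ≤ ENNReal.ofReal (2 * π)⁻¹ * dirichletEnergy D'.h (φ ∘ Φ) := horizonCapacity_le _ _ _ hφ'
      _ = ENNReal.ofReal (2 * π)⁻¹ * dirichletEnergy D.h φ := by
          rw [dirichletEnergy_comp_eq D D' Φ hiso]
  · -- `ψ ∘ Φ⁻¹` is a test function for `(e, U)` with the same energy
    have hψ' : IsCapacityTestFn e U (ψ ∘ Φ.symm) :=
      (isCapacityTestFn_comp_symm_iff hR hchart hU ψ).2 hψ
    have hfun : (ψ ∘ Φ.symm) ∘ (Φ : X' → X) = ψ := funext fun x ↦ by simp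
    calc horizonCapacity D.h e U
        ≤ ENNReal.ofReal (2 * π)⁻¹ * dirichletEnergy D.h (ψ ∘ Φ.symm) :=
          horizonCapacity_le _ _ _ hψ'
      _ = ENNReal.ofReal (2 * π)⁻¹ * dirichletEnergy D'.h ψ := by
          rw [← dirichletEnergy_comp_eq D D' Φ hiso (ψ ∘ Φ.symm), hfun]

end Energy

end Literature.Geometry.Lorentzian

end
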